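import Literature.Analysis.OperatorTheory.NormContinuousGroup
import Literature.MathematicalPhysics.QuantumLattice.LieTrotter
import Mathlib.LinearAlgebra.Matrix.SpecialLinearGroup
import Mathlib.Topology.Algebra.Group.Matrix
import Mathlib.Analysis.Matrix.Normed
import Mathlib.Analysis.Complex.CauchyIntegral
import Mathlib.Analysis.SpecialFunctions.Trigonometric.Deriv
import Mathlib.Analysis.SpecialFunctions.Trigonometric.DerivHyp
import Mathlib.Data.Fintype.Parity
import HarnessLib

/-!
# One-parameter subgroups of `SL(2, ℂ)` under a continuous finite-dimensional representation:
`exp (πi H) = S(−1)`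

Topic `Literature/MathematicalPhysics/QuantumLattice` (trunk T-AQFT). The representation-theoretic
input of the spin–statistics theorem (Streater–Wightman (1964), §4-4, eq. (4-51): "a consequence
of the transformation law of `Ŵ` under the group `SL(2,C) ⊗ SL(2,C)` … the number of undotted
indices … is even (odd) if the field is of integer (half-odd integer) spin", i.e. the continuation
of the boosts of a finite-dimensional representation `S` to imaginary rapidity `2πi` is
`S(−1) = (−1)^{2j}`), proved here for an *arbitrary continuous* finite-dimensional representation
`S : SL(2, ℂ) →* M_ι(ℂ)` without the classification of the irreducible representations:

* `SL2C.gen S hS ξ hξ` — the **generator** of the image `t ↦ S(exp tξ) = exp (t · gen ξ)` of a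
  one-parameter subgroup (`NormContinuousGroup`: norm-continuous one-parameter groups are
  exponentials); it is additive (`gen_add`, through the **Lie product formula** `LieTrotter` and the
  continuity of `S`), homogeneous (`gen_smul`) and `Ad`-equivariant (`gen_conj`): the standard
  construction of the derived representation (Hall, *Lie Groups, Lie Algebras, and Representations*
  (2015), Thm. 3.28 (every continuous homomorphism of matrix Lie groups induces a Lie
  algebra homomorphism), via Thm. 2.11 (Lie product formula) and Cor. 3.50);
* `SL2C.exp_pi_mul_I_smul_genH` — **`exp (πi H) = S(−1)`** for the generator `H` of the
  diagonal subgroup `diag(e^t, e^{−t})`. Proof: with `A = e + f`, `K = e − f`,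
  `Ad(exp cA) h = cosh(2c) h − sinh(2c) K` in `sl(2)` (a `2 × 2` computation), hence
  `e^{cA'} H e^{−cA'} = cosh(2c) H − sinh(2c) K'` for the generators `H, A', K'` and real `c`; both
  sides are entire in `c`, so the identity persists at `c = iπ/4`, where it reads
  `e^{(iπ/4)A'} H e^{−(iπ/4)A'} = −i K'`; exponentiating, `exp(πi H)` is conjugate to
  `exp(π K') = S(exp π(e − f)) = S(−1)`, which is central.

Hence, for the boosts `B(χ) = Λ(diag(e^{χ/2}, e^{−χ/2}))` with generator `Y = H/2`,
`exp (2πi Y) = S(−1)` (`exp_two_pi_mul_I_smul_half_genH`): the input of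
`Literature.Analysis.FunctionSpaces.spin_statistics`.

## References

* B. C. Hall, *Lie Groups, Lie Algebras, and Representations*, 2nd ed., Springer GTM 222 (2015),
  Thm. 2.11 (Lie product formula), Thm. 3.28, Cor. 3.50. [Hall2015]
* R. F. Streater, A. S. Wightman, *PCT, Spin and Statistics, and All That* (1964), §1-3
  (eqs. (1-26)–(1-30): the one-parameter subgroups of `SL(2, ℂ)`), §4-4 eq. (4-51).
  [StreaterWightman1964]

## Mathlib / tree

`Matrix.SpecialLinearGroup` with its topology (`Mathlib.Topology.Algebra.Group.Matrix`), the
`L^∞` operator norm on matrices (`open scoped Matrix.Norms.Operator`), `NormedSpace.exp`,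
`exp_units_conj'`, `hasDerivAt_exp_smul_const'`, `Differentiable.analyticAt` and
`AnalyticOnNhd.eqOn_of_preconnected_of_frequently_eq` (identity theorem); from the tree
`tendsto_lieTrotter` (`LieTrotter`) and `exists_eq_exp_smul_of_continuous`, `generator_unique`,
`commute_generator` (`NormContinuousGroup`).
-/

noncomputable section

open NormedSpace Filter Set Complex
open _root_.Topology
open scoped Matrix.Norms.Operator MatrixGroups Real

namespace Literature.MathematicalPhysics.QuantumLattice

namespace SL2C

/-- `2 × 2` complex matrices. [folklore] -/
abbrev M2 : Type := Matrix (Fin 2) (Fin 2) ℂ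

/-! ### One-parameter groups with prescribed derivative -/

section Deriv

variable {A : Type*} [NormedRing A] [NormedAlgebra ℝ A] [NormedAlgebra ℚ A] [CompleteSpace A]

/-- A continuous one-parameter group with derivative `X₀` at `0` is `t ↦ exp (t X₀)`
(`NormContinuousGroup` and uniqueness of the derivative). [cite: EngelNagel2000, Ch. I Thm 3.7] -/
theorem eq_exp_smul_of_hasDerivAt {g : ℝ → A} (hg : Continuous g) (h0 : g 0 = 1)
    (hmul : ∀ s t, g (s + t) = g s * g t) {X₀ : A} (hd : HasDerivAt g X₀ 0) (t : ℝ) :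
    g t = exp (t • X₀) := by
  obtain ⟨X, hX⟩ := Literature.Analysis.OperatorTheory.exists_eq_exp_smul_of_continuous hg h0 hmul
  have h1 := Literature.Analysis.OperatorTheory.hasDerivAt_of_eq_exp_smul hX 0
  rw [h0, one_mul] at h1
  rw [hX t, hd.unique h1]

omit [NormedAlgebra ℝ A] in
/-- Conjugating an exponential by a two-sided invertible element: `exp (P x Q) = P (exp x) Q` when
`P Q = Q P = 1` (Mathlib's `exp_units_conj`, unbundled). [folklore] -/
theorem exp_conj_of_mul_eq_one {P Q : A} (hPQ : P * Q = 1) (hQP : Q * P = 1) (x : A) :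
    exp (P * x * Q) = P * exp x * Q :=
  exp_units_conj ⟨P, Q, hPQ, hQP⟩ x

end Deriv

/-! ### The basis `h`, `k = e − f`, `a = e + f` of `sl(2, ℝ)` and its one-parameter groups -/

/-- `h = diag(1, −1)`. [cite: StreaterWightman1964, §1-3] -/
def hMat : M2 := !![1, 0; 0, -1]

/-- `k = e − f`, the generator of the rotations `!![cos θ, sin θ; −sin θ, cos θ]`.
[cite: StreaterWightman1964, §1-3] -/
def kMat : M2 := !![0, 1; -1, 0]

/-- `a = e + f`, the generator of the symmetric boosts `!![cosh c, sinh c; sinh c, cosh c]`.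
[cite: StreaterWightman1964, §1-3] -/
def aMat : M2 := !![0, 1; 1, 0]

/-- `h² = 1`. [folklore] -/
theorem hMat_sq : hMat * hMat = 1 := by
  ext i j; fin_cases i <;> fin_cases j <;> simp [hMat]

/-- `k² = −1`. [folklore] -/
theorem kMat_sq : kMat * kMat = -1 := by
  ext i j; fin_cases i <;> fin_cases j <;> simp [kMat]

/-- `a² = 1`. [folklore] -/
theorem aMat_sq : aMat * aMat = 1 := by
  ext i j; fin_cases i <;> fin_cases j <;> simp [aMat]

/-- The one-parameter group `c₁(t) 1 + c₂(t) X` generated by a matrix with `X² = ε 1`: group law from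
the addition formulas. Hyperbolic case `X² = 1`: `(cosh s + sinh s X)(cosh t + sinh t X) =
cosh(s+t) + sinh(s+t) X`. [folklore] -/
theorem hypGroup_mul {X : M2} (hX : X * X = 1) (s t : ℝ) :
    ((Real.cosh s : ℂ) • (1 : M2) + (Real.sinh s : ℂ) • X) *
      ((Real.cosh t : ℂ) • (1 : M2) + (Real.sinh t : ℂ) • X) =
      (Real.cosh (s + t) : ℂ) • (1 : M2) + (Real.sinh (s + t) : ℂ) • X := by
  rw [Real.cosh_add, Real.sinh_add]
  simp only [mul_add, add_mul, smul_mul_smul_comm, one_mul, mul_one, hX]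
  push_cast
  simp only [add_smul]
  abel_nf

/-- Circular case `X² = −1`: `(cos s + sin s X)(cos t + sin t X) = cos(s+t) + sin(s+t) X`. [folklore] -/
theorem circGroup_mul {X : M2} (hX : X * X = -1) (s t : ℝ) :
    ((Real.cos s : ℂ) • (1 : M2) + (Real.sin s : ℂ) • X) *
      ((Real.cos t : ℂ) • (1 : M2) + (Real.sin t : ℂ) • X) =
      (Real.cos (s + t) : ℂ) • (1 : M2) + (Real.sin (s + t) : ℂ) • X := by
  rw [Real.cos_add, Real.sin_add]
  simp only [mul_add, add_mul, smul_mul_smul_comm, one_mul, mul_one, hX, smul_neg]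
  push_cast
  simp only [add_smul, sub_eq_add_neg, neg_smul]
  abel_nf

/-- The diagonal subgroup `diag(e^t, e^{−t}) = cosh t · 1 + sinh t · h`.
[cite: StreaterWightman1964, §1-3 eq. (1-26)] -/
def diagGrp (t : ℝ) : M2 := (Real.cosh t : ℂ) • (1 : M2) + (Real.sinh t : ℂ) • hMat

/-- The rotations `!![cos θ, sin θ; −sin θ, cos θ] = cos θ · 1 + sin θ · k`.
[cite: StreaterWightman1964, §1-3 eq. (1-27)] -/
def rotGrp (θ : ℝ) : M2 := (Real.cos θ : ℂ) • (1 : M2) + (Real.sin θ : ℂ) • kMat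

/-- The symmetric boosts `!![cosh c, sinh c; sinh c, cosh c] = cosh c · 1 + sinh c · a`.
[cite: StreaterWightman1964, §1-3 eq. (1-26)] -/
def symGrp (c : ℝ) : M2 := (Real.cosh c : ℂ) • (1 : M2) + (Real.sinh c : ℂ) • aMat

/-- Group law of the diagonal subgroup. [folklore] -/
theorem diagGrp_add (s t : ℝ) : diagGrp (s + t) = diagGrp s * diagGrp t :=
  (hypGroup_mul hMat_sq s t).symm

/-- Group law of the rotation subgroup. [folklore] -/
theorem rotGrp_add (s t : ℝ) : rotGrp (s + t) = rotGrp s * rotGrp t :=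
  (circGroup_mul kMat_sq s t).symm

/-- Group law of the symmetric boosts. [folklore] -/
theorem symGrp_add (s t : ℝ) : symGrp (s + t) = symGrp s * symGrp t :=
  (hypGroup_mul aMat_sq s t).symm

/-- `diagGrp 0 = 1`. [folklore] -/
@[simp] theorem diagGrp_zero : diagGrp 0 = 1 := by simp [diagGrp]

/-- `rotGrp 0 = 1`. [folklore] -/
@[simp] theorem rotGrp_zero : rotGrp 0 = 1 := by simp [rotGrp]

/-- `symGrp 0 = 1`. [folklore] -/
@[simp] theorem symGrp_zero : symGrp 0 = 1 := by simp [symGrp]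

/-- Derivative of a hyperbolic one-parameter group at `0` is its generator. [folklore] -/
theorem hasDerivAt_hypGroup_zero (X : M2) :
    HasDerivAt (fun t : ℝ => (Real.cosh t : ℂ) • (1 : M2) + (Real.sinh t : ℂ) • X) X 0 := by
  have h1 := ((Real.hasDerivAt_cosh 0).ofReal_comp).smul_const (1 : M2)
  have h2 := ((Real.hasDerivAt_sinh 0).ofReal_comp).smul_const X
  have h := h1.add h2
  simp only [Real.sinh_zero, Complex.ofReal_zero, zero_smul, Real.cosh_zero, Complex.ofReal_one,
    one_smul, zero_add] at h
  exact h

/-- Derivative of a circular one-parameter group at `0` is its generator. [folklore] -/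
theorem hasDerivAt_circGroup_zero (X : M2) :
    HasDerivAt (fun t : ℝ => (Real.cos t : ℂ) • (1 : M2) + (Real.sin t : ℂ) • X) X 0 := by
  have h1 := ((Real.hasDerivAt_cos 0).ofReal_comp).smul_const (1 : M2)
  have h2 := ((Real.hasDerivAt_sin 0).ofReal_comp).smul_const X
  have h := h1.add h2
  simp only [Real.sin_zero, neg_zero, Complex.ofReal_zero, zero_smul, Real.cos_zero,
    Complex.ofReal_one, one_smul, zero_add] at h
  exact h

/-- Continuity of a hyperbolic one-parameter group. [folklore] -/
theorem continuous_hypGroup (X : M2) :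
    Continuous fun t : ℝ => (Real.cosh t : ℂ) • (1 : M2) + (Real.sinh t : ℂ) • X :=
  ((Complex.continuous_ofReal.comp Real.continuous_cosh).smul continuous_const).add
    ((Complex.continuous_ofReal.comp Real.continuous_sinh).smul continuous_const)

/-- Continuity of a circular one-parameter group. [folklore] -/
theorem continuous_circGroup (X : M2) :
    Continuous fun t : ℝ => (Real.cos t : ℂ) • (1 : M2) + (Real.sin t : ℂ) • X :=
  ((Complex.continuous_ofReal.comp Real.continuous_cos).smul continuous_const).add
    ((Complex.continuous_ofReal.comp Real.continuous_sin).smul continuous_const)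

/-- **`diag(e^t, e^{−t}) = exp (t h)`.** [cite: StreaterWightman1964, §1-3 eq. (1-26)] -/
theorem diagGrp_eq_exp (t : ℝ) : diagGrp t = exp (t • hMat) :=
  eq_exp_smul_of_hasDerivAt (g := diagGrp) (continuous_hypGroup hMat) diagGrp_zero diagGrp_add
    (hasDerivAt_hypGroup_zero hMat) t

/-- **`!![cos θ, sin θ; −sin θ, cos θ] = exp (θ (e − f))`.** [cite: StreaterWightman1964, §1-3 eq. (1-27)] -/
theorem rotGrp_eq_exp (θ : ℝ) : rotGrp θ = exp (θ • kMat) :=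
  eq_exp_smul_of_hasDerivAt (g := rotGrp) (continuous_circGroup kMat) rotGrp_zero rotGrp_add
    (hasDerivAt_circGroup_zero kMat) θ

/-- **`!![cosh c, sinh c; sinh c, cosh c] = exp (c (e + f))`.** [cite: StreaterWightman1964, §1-3] -/
theorem symGrp_eq_exp (c : ℝ) : symGrp c = exp (c • aMat) :=
  eq_exp_smul_of_hasDerivAt (g := symGrp) (continuous_hypGroup aMat) symGrp_zero symGrp_add
    (hasDerivAt_hypGroup_zero aMat) c

/-- `det diag(e^t, e^{−t}) = cosh² − sinh² = 1`. [folklore] -/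
theorem det_diagGrp (t : ℝ) : (diagGrp t).det = 1 := by
  have h := Complex.cosh_sq_sub_sinh_sq (t : ℂ)
  rw [Matrix.det_fin_two]
  simp [diagGrp, hMat, Matrix.smul_apply, -Complex.cosh_add_sinh, -Complex.sinh_add_cosh,
    -Complex.cosh_sub_sinh, -Complex.sinh_sub_cosh]
  linear_combination h

/-- `det !![cos θ, sin θ; −sin θ, cos θ] = 1`. [folklore] -/
theorem det_rotGrp (θ : ℝ) : (rotGrp θ).det = 1 := by
  have h := Complex.cos_sq_add_sin_sq (θ : ℂ)
  rw [Matrix.det_fin_two]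
  simp [rotGrp, kMat, Matrix.smul_apply]
  linear_combination h

/-- `det !![cosh c, sinh c; sinh c, cosh c] = 1`. [folklore] -/
theorem det_symGrp (c : ℝ) : (symGrp c).det = 1 := by
  have h := Complex.cosh_sq_sub_sinh_sq (c : ℂ)
  rw [Matrix.det_fin_two]
  simp [symGrp, aMat, Matrix.smul_apply, -Complex.cosh_add_sinh, -Complex.sinh_add_cosh,
    -Complex.cosh_sub_sinh, -Complex.sinh_sub_cosh]
  linear_combination h

/-- The rotation by `π` is `−1`. [folklore] -/
theorem rotGrp_pi : rotGrp π = -1 := by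
  simp [rotGrp]

/-- **The adjoint action of the symmetric boosts on `h`**:
`exp(c a) h exp(−c a) = cosh(2c) h − sinh(2c) (e − f)` (`a h = −h a`, `h a = e − f`).
[cite: Hall2015, Prop. 3.35] -/
theorem symGrp_mul_hMat_mul_symGrp_neg (c : ℝ) :
    symGrp c * hMat * symGrp (-c) = (Real.cosh (2 * c) : ℂ) • hMat - (Real.sinh (2 * c) : ℂ) • kMat := by
  rw [Real.cosh_two_mul, Real.sinh_two_mul]
  simp only [symGrp, hMat, kMat, aMat, Real.cosh_neg, Real.sinh_neg]
  ext i j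
  fin_cases i <;> fin_cases j <;>
    · simp [Matrix.mul_apply, Fin.sum_univ_two, Matrix.smul_apply, Matrix.one_apply,
        -Complex.cosh_add_sinh, -Complex.sinh_add_cosh, -Complex.cosh_sub_sinh, -Complex.sinh_sub_cosh]
      ring

/-! ### Generators of one-parameter subgroups under a continuous representation -/

/-- `ξ ∈ M₂(ℂ)` **generates a one-parameter subgroup of `SL(2, ℂ)`**: `det exp(t ξ) = 1` for all
real `t` (equivalently `tr ξ = 0`; we use the determinant form, which is what is needed).
[cite: Hall2015, Thm 2.12] -/
def IsGen (ξ : M2) : Prop := ∀ t : ℝ, Matrix.det (exp (t • ξ)) = 1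

/-- `h` generates a one-parameter subgroup of `SL(2, ℂ)`. [folklore] -/
theorem isGen_hMat : IsGen hMat := fun t => by rw [← diagGrp_eq_exp, det_diagGrp]

/-- `k = e − f` generates a one-parameter subgroup of `SL(2, ℂ)`. [folklore] -/
theorem isGen_kMat : IsGen kMat := fun t => by rw [← rotGrp_eq_exp, det_rotGrp]

/-- `a = e + f` generates a one-parameter subgroup of `SL(2, ℂ)`. [folklore] -/
theorem isGen_aMat : IsGen aMat := fun t => by rw [← symGrp_eq_exp, det_symGrp]

/-- The **one-parameter subgroup `t ↦ exp (t ξ)` of `SL(2, ℂ)`** generated by `ξ`.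
[cite: Hall2015, Def 2.13] -/
def toSL (ξ : M2) (hξ : IsGen ξ) (t : ℝ) : SL(2, ℂ) := ⟨exp (t • ξ), hξ t⟩

/-- Coercion of `toSL`. [folklore] -/
@[simp] theorem coe_toSL {ξ : M2} (hξ : IsGen ξ) (t : ℝ) : (toSL ξ hξ t : M2) = exp (t • ξ) := rfl

/-- `exp (0 ξ) = 1`. [folklore] -/
theorem toSL_zero {ξ : M2} (hξ : IsGen ξ) : toSL ξ hξ 0 = 1 := Subtype.ext (by simp)

/-- Group law. [folklore] -/
theorem toSL_add {ξ : M2} (hξ : IsGen ξ) (s t : ℝ) : toSL ξ hξ (s + t) = toSL ξ hξ s * toSL ξ hξ t :=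
  Subtype.ext (by
    simp only [coe_toSL, Matrix.SpecialLinearGroup.coe_mul]
    exact Literature.Analysis.OperatorTheory.exp_add_smul ξ s t)

/-- Continuity of `t ↦ exp (t ξ) ∈ SL(2, ℂ)`. [folklore] -/
theorem continuous_toSL {ξ : M2} (hξ : IsGen ξ) : Continuous (toSL ξ hξ) :=
  Continuous.subtype_mk (exp_continuous.comp (continuous_id.smul continuous_const)) _

section Rep

variable {ι : Type*} [Fintype ι] [DecidableEq ι]
variable (S : SL(2, ℂ) →* Matrix ι ι ℂ)

/-- The image of a one-parameter subgroup under a continuous representation is a norm-continuous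
one-parameter group of matrices, hence an exponential. [cite: Hall2015, Thm 3.28] -/
theorem exists_eq_exp_gen (hS : Continuous S) {ξ : M2} (hξ : IsGen ξ) :
    ∃ X : Matrix ι ι ℂ, ∀ t : ℝ, S (toSL ξ hξ t) = exp (t • X) :=
  Literature.Analysis.OperatorTheory.exists_eq_exp_smul_of_continuous
    (hS.comp (continuous_toSL hξ)) (by rw [toSL_zero, map_one]) fun s t => by rw [toSL_add, map_mul]

/-- The **generator** of the image of the one-parameter subgroup `exp (t ξ)` under `S`:
`S (exp t ξ) = exp (t · gen ξ)` (the derived representation on `ξ`; Hall (2015), Thm. 3.28).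
[cite: Hall2015, Thm 3.28] -/
def gen (hS : Continuous S) (ξ : M2) (hξ : IsGen ξ) : Matrix ι ι ℂ := (exists_eq_exp_gen S hS hξ).choose

/-- Defining property of the generator. [cite: Hall2015, Thm 3.28] -/
theorem apply_toSL (hS : Continuous S) {ξ : M2} (hξ : IsGen ξ) (t : ℝ) :
    S (toSL ξ hξ t) = exp (t • gen S hS ξ hξ) :=
  (exists_eq_exp_gen S hS hξ).choose_spec t

/-- The generator does not depend on how the matrix is written. [folklore] -/
theorem gen_congr (hS : Continuous S) {ξ ξ' : M2} (hξ : IsGen ξ) (hξ' : IsGen ξ') (h : ξ = ξ') :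
    gen S hS ξ hξ = gen S hS ξ' hξ' := by subst h; rfl

/-- **Homogeneity**: scalar multiples generate reparametrised subgroups. [folklore] -/
theorem isGen_smul (c : ℝ) {ξ : M2} (hξ : IsGen ξ) : IsGen (c • ξ) := fun t => by
  rw [smul_smul]; exact hξ _

/-- `gen (c ξ) = c · gen ξ` (for any proof `h` that `c ξ` generates). [cite: Hall2015, Thm 3.28] -/
theorem gen_smul (hS : Continuous S) (c : ℝ) {ξ : M2} (hξ : IsGen ξ) (h : IsGen (c • ξ)) :
    gen S hS (c • ξ) h = c • gen S hS ξ hξ := by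
  show gen S hS (c • ξ) (isGen_smul c hξ) = c • gen S hS ξ hξ
  refine Literature.Analysis.OperatorTheory.generator_unique fun t => ?_
  have h1 : toSL (c • ξ) (isGen_smul c hξ) t = toSL ξ hξ (t * c) := Subtype.ext (by simp [smul_smul])
  calc exp (t • gen S hS (c • ξ) (isGen_smul c hξ)) = S (toSL (c • ξ) (isGen_smul c hξ) t) :=
        (apply_toSL S hS (isGen_smul c hξ) t).symm
    _ = S (toSL ξ hξ (t * c)) := by rw [h1]
    _ = exp ((t * c) • gen S hS ξ hξ) := apply_toSL S hS hξ (t * c)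
    _ = exp (t • c • gen S hS ξ hξ) := by rw [smul_smul]

/-- **Additivity of generators** on the level of `SL(2, ℂ)`: if `ξ` and `ζ` generate subgroups of
`SL(2, ℂ)` then so does `ξ + ζ` (Lie product formula: `exp t(ξ + ζ) = lim (exp (tξ/N) exp (tζ/N))^N`
has determinant `1`). [cite: Hall2015, Thm 2.11] -/
theorem isGen_add {ξ ζ : M2} (hξ : IsGen ξ) (hζ : IsGen ζ) : IsGen (ξ + ζ) := by
  intro t
  have htr := tendsto_lieTrotter (𝕂 := ℝ) (t • ξ) (t • ζ)
  have hcont : Continuous fun A : M2 => A.det := continuous_id.matrix_det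
  have hdet : Tendsto (fun N : ℕ => ((exp ((N : ℝ)⁻¹ • (t • ξ)) * exp ((N : ℝ)⁻¹ • (t • ζ))) ^ N).det)
      atTop (𝓝 ((exp (t • ξ + t • ζ)).det)) := (hcont.tendsto _).comp htr
  have h1 : (fun N : ℕ => ((exp ((N : ℝ)⁻¹ • (t • ξ)) * exp ((N : ℝ)⁻¹ • (t • ζ))) ^ N).det) =
      fun _ => 1 := by
    funext N
    rw [Matrix.det_pow, Matrix.det_mul, smul_smul, smul_smul, hξ, hζ, one_mul, one_pow]
  rw [h1] at hdet
  rw [smul_add]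
  exact (tendsto_nhds_unique tendsto_const_nhds hdet).symm

/-- **Additivity of the generators**: `gen (ξ + ζ) = gen ξ + gen ζ` — the Lie product formula in
`SL(2, ℂ)` and in `M_ι(ℂ)`, and the continuity of `S` (Hall (2015), Thm. 3.28, proof of point 3).
[cite: Hall2015, Thm 3.28] -/
theorem gen_add [Nonempty ι] (hS : Continuous S) {ξ ζ : M2} (hξ : IsGen ξ) (hζ : IsGen ζ)
    (h : IsGen (ξ + ζ)) : gen S hS (ξ + ζ) h = gen S hS ξ hξ + gen S hS ζ hζ := by
  show gen S hS (ξ + ζ) (isGen_add hξ hζ) = gen S hS ξ hξ + gen S hS ζ hζ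
  refine Literature.Analysis.OperatorTheory.generator_unique fun t => ?_
  -- the Trotter sequence in `SL(2, ℂ)` and its convergence
  set u : ℕ → SL(2, ℂ) := fun N => (toSL ξ hξ ((N : ℝ)⁻¹ * t) * toSL ζ hζ ((N : ℝ)⁻¹ * t)) ^ N
    with hu
  have hcoe : ∀ N, (u N : M2) = (exp ((N : ℝ)⁻¹ • (t • ξ)) * exp ((N : ℝ)⁻¹ • (t • ζ))) ^ N := by
    intro N
    simp only [hu, Matrix.SpecialLinearGroup.coe_pow, Matrix.SpecialLinearGroup.coe_mul, coe_toSL,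
      smul_smul]
  have hlim : Tendsto u atTop (𝓝 (toSL (ξ + ζ) (isGen_add hξ hζ) t)) := by
    refine ((Matrix.SpecialLinearGroup.isClosedEmbedding_val (n := Fin 2) (R := ℂ)).isInducing.tendsto_nhds_iff).2 ?_
    have htr := tendsto_lieTrotter (𝕂 := ℝ) (t • ξ) (t • ζ)
    rw [← smul_add] at htr
    refine htr.congr fun N => ?_
    exact (hcoe N).symm
  -- apply `S`
  have h1 : Tendsto (fun N => S (u N)) atTop (𝓝 (exp (t • gen S hS (ξ + ζ) (isGen_add hξ hζ)))) := by
    rw [← apply_toSL S hS]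
    exact (hS.tendsto _).comp hlim
  have h2 : Tendsto (fun N => S (u N)) atTop (𝓝 (exp (t • gen S hS ξ hξ + t • gen S hS ζ hζ))) := by
    have htr := tendsto_lieTrotter (𝕂 := ℝ) (t • gen S hS ξ hξ) (t • gen S hS ζ hζ)
    refine htr.congr fun N => ?_
    simp only [hu, map_pow, map_mul, apply_toSL S hS hξ, apply_toSL S hS hζ, smul_smul]
    rfl
  calc exp (t • gen S hS (ξ + ζ) (isGen_add hξ hζ)) = exp (t • gen S hS ξ hξ + t • gen S hS ζ hζ) :=
        tendsto_nhds_unique h1 h2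
    _ = exp (t • (gen S hS ξ hξ + gen S hS ζ hζ)) := by rw [smul_add]

/-- **Conjugates** of generators generate: `exp (t g ξ g⁻¹) = g exp(t ξ) g⁻¹`. [cite: Hall2015, Prop 2.3] -/
theorem isGen_conj (g : SL(2, ℂ)) {ξ : M2} (hξ : IsGen ξ) : IsGen ((g : M2) * ξ * ((g⁻¹ : SL(2, ℂ)) : M2)) := by
  intro t
  have hgg : (g : M2) * ((g⁻¹ : SL(2, ℂ)) : M2) = 1 := by
    rw [← Matrix.SpecialLinearGroup.coe_mul, mul_inv_cancel, Matrix.SpecialLinearGroup.coe_one]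
  have hgg' : ((g⁻¹ : SL(2, ℂ)) : M2) * (g : M2) = 1 := by
    rw [← Matrix.SpecialLinearGroup.coe_mul, inv_mul_cancel, Matrix.SpecialLinearGroup.coe_one]
  have e1 : t • ((g : M2) * ξ * ((g⁻¹ : SL(2, ℂ)) : M2)) = (g : M2) * (t • ξ) * ((g⁻¹ : SL(2, ℂ)) : M2) := by
    simp
  have h : exp (t • ((g : M2) * ξ * ((g⁻¹ : SL(2, ℂ)) : M2))) =
      (g : M2) * exp (t • ξ) * ((g⁻¹ : SL(2, ℂ)) : M2) :=
    (congrArg NormedSpace.exp e1).trans (exp_conj_of_mul_eq_one hgg hgg' (t • ξ))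
  calc Matrix.det (exp (t • ((g : M2) * ξ * ((g⁻¹ : SL(2, ℂ)) : M2))))
      = Matrix.det ((g : M2) * exp (t • ξ) * ((g⁻¹ : SL(2, ℂ)) : M2)) := congrArg Matrix.det h
    _ = 1 := by
        rw [Matrix.det_mul, Matrix.det_mul, Matrix.SpecialLinearGroup.det_coe,
          Matrix.SpecialLinearGroup.det_coe, hξ t, mul_one, mul_one]

/-- **`Ad`-equivariance of the generators**: `gen (g ξ g⁻¹) = S(g) · gen ξ · S(g)⁻¹`
(Hall (2015), Thm. 3.28, point 2). [cite: Hall2015, Thm 3.28] -/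
theorem gen_conj (hS : Continuous S) (g : SL(2, ℂ)) {ξ : M2} (hξ : IsGen ξ)
    (h : IsGen ((g : M2) * ξ * ((g⁻¹ : SL(2, ℂ)) : M2))) :
    gen S hS ((g : M2) * ξ * ((g⁻¹ : SL(2, ℂ)) : M2)) h = S g * gen S hS ξ hξ * S g⁻¹ := by
  show gen S hS ((g : M2) * ξ * ((g⁻¹ : SL(2, ℂ)) : M2)) (isGen_conj g hξ) = _
  have hSS : S g * S g⁻¹ = 1 := by rw [← map_mul, mul_inv_cancel, map_one]
  have hSS' : S g⁻¹ * S g = 1 := by rw [← map_mul, inv_mul_cancel, map_one]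
  refine Literature.Analysis.OperatorTheory.generator_unique fun t => ?_
  have hgg : (g : M2) * ((g⁻¹ : SL(2, ℂ)) : M2) = 1 := by
    rw [← Matrix.SpecialLinearGroup.coe_mul, mul_inv_cancel, Matrix.SpecialLinearGroup.coe_one]
  have hgg' : ((g⁻¹ : SL(2, ℂ)) : M2) * (g : M2) = 1 := by
    rw [← Matrix.SpecialLinearGroup.coe_mul, inv_mul_cancel, Matrix.SpecialLinearGroup.coe_one]
  -- the conjugated subgroup is `g exp(t ξ) g⁻¹`
  have e1 : t • ((g : M2) * ξ * ((g⁻¹ : SL(2, ℂ)) : M2)) = (g : M2) * (t • ξ) * ((g⁻¹ : SL(2, ℂ)) : M2) := by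
    simp
  have h : exp (t • ((g : M2) * ξ * ((g⁻¹ : SL(2, ℂ)) : M2))) =
      (g : M2) * exp (t • ξ) * ((g⁻¹ : SL(2, ℂ)) : M2) :=
    (congrArg NormedSpace.exp e1).trans (exp_conj_of_mul_eq_one hgg hgg' (t • ξ))
  have h1 : toSL _ (isGen_conj g hξ) t = g * toSL ξ hξ t * g⁻¹ := by
    apply Subtype.ext
    simp only [coe_toSL, Matrix.SpecialLinearGroup.coe_mul]
    exact h
  have h2 : t • (S g * gen S hS ξ hξ * S g⁻¹) = S g * (t • gen S hS ξ hξ) * S g⁻¹ := by simp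
  have hconj' : exp (t • (S g * gen S hS ξ hξ * S g⁻¹)) = S g * exp (t • gen S hS ξ hξ) * S g⁻¹ :=
    (congrArg NormedSpace.exp h2).trans (exp_conj_of_mul_eq_one hSS hSS' (t • gen S hS ξ hξ))
  calc exp (t • gen S hS _ (isGen_conj g hξ)) = S (toSL _ (isGen_conj g hξ) t) :=
        (apply_toSL S hS (isGen_conj g hξ) t).symm
    _ = S g * exp (t • gen S hS ξ hξ) * S g⁻¹ := by rw [h1, map_mul, map_mul, apply_toSL S hS hξ]
    _ = exp (t • (S g * gen S hS ξ hξ * S g⁻¹)) := hconj'.symm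

/-- Elements commuting with a one-parameter subgroup commute with the image of its generator.
[folklore] -/
theorem commute_gen (hS : Continuous S) (g : SL(2, ℂ)) {ξ : M2} (hξ : IsGen ξ)
    (h : ∀ t : ℝ, g * toSL ξ hξ t = toSL ξ hξ t * g) : Commute (S g) (gen S hS ξ hξ) := by
  refine Literature.Analysis.OperatorTheory.commute_generator fun t => ?_
  show Commute (S g) (exp (t • gen S hS ξ hξ))
  rw [← apply_toSL S hS hξ t]
  change S g * S (toSL ξ hξ t) = S (toSL ξ hξ t) * S g
  rw [← map_mul, ← map_mul, h t]

end Rep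

/-! ### `exp (πi H) = S(−1)` -/

section Main

variable {ι : Type*} [Fintype ι] [DecidableEq ι] [Nonempty ι]
variable (S : SL(2, ℂ) →* Matrix ι ι ℂ)

/-- The coercion of the diagonal subgroup: `exp (t h) = cosh t · 1 + sinh t · h`. [folklore] -/
theorem coe_toSL_hMat (t : ℝ) : (toSL hMat isGen_hMat t : M2) = diagGrp t := by
  rw [coe_toSL, diagGrp_eq_exp]

/-- The coercion of the rotation subgroup. [folklore] -/
theorem coe_toSL_kMat (θ : ℝ) : (toSL kMat isGen_kMat θ : M2) = rotGrp θ := by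
  rw [coe_toSL, rotGrp_eq_exp]

/-- The coercion of the symmetric boosts. [folklore] -/
theorem coe_toSL_aMat (c : ℝ) : (toSL aMat isGen_aMat c : M2) = symGrp c := by
  rw [coe_toSL, symGrp_eq_exp]

/-- `exp (π (e − f)) = −1` in `SL(2, ℂ)`. [folklore] -/
theorem toSL_kMat_pi : toSL kMat isGen_kMat π = -1 :=
  Subtype.ext (by rw [coe_toSL_kMat, rotGrp_pi, Matrix.SpecialLinearGroup.coe_neg,
    Matrix.SpecialLinearGroup.coe_one])

/-- Inverses along a one-parameter subgroup. [folklore] -/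
theorem toSL_neg {ξ : M2} (hξ : IsGen ξ) (t : ℝ) : toSL ξ hξ (-t) = (toSL ξ hξ t)⁻¹ := by
  rw [eq_inv_iff_mul_eq_one, ← toSL_add, neg_add_cancel, toSL_zero]

/-- `−1` is central: it commutes with every one-parameter subgroup. [folklore] -/
theorem neg_one_mul_toSL {ξ : M2} (hξ : IsGen ξ) (t : ℝ) :
    (-1 : SL(2, ℂ)) * toSL ξ hξ t = toSL ξ hξ t * (-1) := by
  rw [neg_mul, one_mul, mul_neg, mul_one]

/-- **The real conjugation identity**: with `H, K, A'` the generators of the images of the subgroups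
generated by `h`, `k = e − f`, `a = e + f`,
`e^{cA'} H e^{−cA'} = cosh(2c) H − sinh(2c) K` for real `c` (the image under the derived
representation of `Ad(exp ca) h = cosh(2c) h − sinh(2c) k`). [cite: Hall2015, Thm 3.28] -/
theorem exp_mul_genH_mul_exp_neg (hS : Continuous S) (c : ℝ) :
    exp (c • gen S hS aMat isGen_aMat) * gen S hS hMat isGen_hMat * exp ((-c) • gen S hS aMat isGen_aMat) =
      Real.cosh (2 * c) • gen S hS hMat isGen_hMat + (-Real.sinh (2 * c)) • gen S hS kMat isGen_kMat := by
  set g : SL(2, ℂ) := toSL aMat isGen_aMat c with hg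
  -- the conjugated matrix
  have hmat : (g : M2) * hMat * ((g⁻¹ : SL(2, ℂ)) : M2) =
      Real.cosh (2 * c) • hMat + (-Real.sinh (2 * c)) • kMat := by
    rw [hg, ← toSL_neg, coe_toSL_aMat, coe_toSL_aMat, symGrp_mul_hMat_mul_symGrp_neg,
      sub_eq_add_neg, ← neg_smul, Complex.coe_smul, ← Complex.ofReal_neg, Complex.coe_smul]
  have hgen : IsGen (Real.cosh (2 * c) • hMat + (-Real.sinh (2 * c)) • kMat) :=
    isGen_add (isGen_smul _ isGen_hMat) (isGen_smul _ isGen_kMat)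
  have h1 : gen S hS _ (isGen_conj g isGen_hMat) = S g * gen S hS hMat isGen_hMat * S g⁻¹ :=
    gen_conj S hS g isGen_hMat _
  have h2 : gen S hS _ (isGen_conj g isGen_hMat) = gen S hS _ hgen := gen_congr S hS _ _ hmat
  have h3 : gen S hS _ hgen =
      Real.cosh (2 * c) • gen S hS hMat isGen_hMat + (-Real.sinh (2 * c)) • gen S hS kMat isGen_kMat := by
    rw [gen_add S hS (isGen_smul _ isGen_hMat) (isGen_smul _ isGen_kMat),
      gen_smul S hS _ isGen_hMat, gen_smul S hS _ isGen_kMat]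
  have hSg : S g = exp (c • gen S hS aMat isGen_aMat) := apply_toSL S hS isGen_aMat c
  have hSg' : S g⁻¹ = exp ((-c) • gen S hS aMat isGen_aMat) := by
    rw [hg, ← toSL_neg, apply_toSL S hS isGen_aMat]
  rw [← hSg, ← hSg', ← h1, h2, h3]

/-- **The complex conjugation identity** (analytic continuation of the real one in the rapidity `c`:
both sides are entire; identity theorem):
`e^{zA'} H e^{−zA'} = cosh(2z) H − sinh(2z) K` for all complex `z`. [cite: StreaterWightman1964, §4-4 eq. (4-51)] -/
theorem exp_mul_genH_mul_exp_neg_complex (hS : Continuous S) (z : ℂ) :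
    exp (z • gen S hS aMat isGen_aMat) * gen S hS hMat isGen_hMat * exp (z • (-gen S hS aMat isGen_aMat)) =
      Complex.cosh (2 * z) • gen S hS hMat isGen_hMat - Complex.sinh (2 * z) • gen S hS kMat isGen_kMat := by
  set A' := gen S hS aMat isGen_aMat
  set H := gen S hS hMat isGen_hMat
  set K := gen S hS kMat isGen_kMat
  set F₁ : ℂ → Matrix ι ι ℂ := fun z => exp (z • A') * H * exp (z • (-A')) with hF₁
  set F₂ : ℂ → Matrix ι ι ℂ := fun z => Complex.cosh (2 * z) • H - Complex.sinh (2 * z) • K with hF₂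
  have hd₁ : Differentiable ℂ F₁ := fun z =>
    (((hasDerivAt_exp_smul_const A' z).differentiableAt.mul_const H).mul
      (hasDerivAt_exp_smul_const (-A') z).differentiableAt)
  have hd₂ : Differentiable ℂ F₂ :=
    ((Complex.differentiable_cosh.comp (differentiable_id.const_mul 2)).smul_const H).sub
      ((Complex.differentiable_sinh.comp (differentiable_id.const_mul 2)).smul_const K)
  -- agreement on the reals
  have hreal : ∀ c : ℝ, F₁ c = F₂ c := by
    intro c
    have h := exp_mul_genH_mul_exp_neg S hS c
    simp only [hF₁, hF₂]
    rw [Complex.coe_smul, smul_neg, ← neg_smul, ← Complex.ofReal_neg, Complex.coe_smul, h,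
      show (2 : ℂ) * c = ((2 * c : ℝ) : ℂ) by push_cast; ring, ← Complex.ofReal_cosh,
      ← Complex.ofReal_sinh, Complex.coe_smul, sub_eq_add_neg, ← neg_smul, ← Complex.ofReal_neg,
      Complex.coe_smul]
  -- identity theorem
  have hfreq : ∃ᶠ w in 𝓝[≠] (0 : ℂ), F₁ w = F₂ w := by
    have ht : Tendsto (fun c : ℝ => (c : ℂ)) (𝓝[≠] 0) (𝓝[≠] 0) := by
      have h := Complex.continuous_ofReal.continuousWithinAt.tendsto_nhdsWithin
        (s := {(0 : ℝ)}ᶜ) (t := {(0 : ℂ)}ᶜ) (x := 0) fun x hx => by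
          simpa [Complex.ofReal_eq_zero] using hx
      rwa [Complex.ofReal_zero] at h
    exact ht.frequently (Eventually.of_forall hreal).frequently
  have heq := AnalyticOnNhd.eqOn_of_preconnected_of_frequently_eq (fun w _ => hd₁.analyticAt w)
    (fun w _ => hd₂.analyticAt w) isPreconnected_univ (mem_univ 0) hfreq
  exact heq (mem_univ z)

/-- **`exp (πi H) = S(−1)`** for the generator `H` of the image of the diagonal subgroup
`diag(e^t, e^{−t})` under a continuous finite-dimensional representation `S` of `SL(2, ℂ)`: the
continuation of the real subgroup `S(diag(e^t, e^{−t})) = e^{tH}` to `t = πi` is `S(−1)`, although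
`diag(e^{πi}, e^{−πi}) = −1` is reached inside `SL(2, ℂ)` only through the *rotations*. This is the
single-valuedness behind Streater–Wightman's (4-51) (`(−1)^J = (−1)^{2j}` on irreducibles).
Proof: at `z = iπ/4` the complex conjugation identity reads `e^{zA'} H e^{−zA'} = −iK`, so
`exp(πi H)` is conjugate to `exp(πK) = S(exp π(e − f)) = S(−1)`, which is central.
[cite: StreaterWightman1964, §4-4 eq. (4-51)] -/
theorem exp_pi_mul_I_smul_genH (hS : Continuous S) :
    exp (((π : ℂ) * I) • gen S hS hMat isGen_hMat) = S (-1) := by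
  set A' := gen S hS aMat isGen_aMat with hA'
  set H := gen S hS hMat isGen_hMat with hH
  set K := gen S hS kMat isGen_kMat with hK
  set z₀ : ℂ := (π / 4 : ℂ) * I with hz₀
  set U : Matrix ι ι ℂ := exp (z₀ • A') with hU
  set U' : Matrix ι ι ℂ := exp (-(z₀ • A')) with hU'
  have hcomm : Commute (z₀ • A') (-(z₀ • A')) := (Commute.refl (z₀ • A')).neg_right
  have hUU' : U * U' = 1 := by
    have h := (exp_add_of_commute hcomm).symm
    rw [add_neg_cancel, NormedSpace.exp_zero] at h
    exact h
  have hU'U : U' * U = 1 := by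
    have h := (exp_add_of_commute hcomm.symm).symm
    rw [neg_add_cancel, NormedSpace.exp_zero] at h
    exact h
  -- the identity at `z₀ = iπ/4`
  have hkey : U * H * U' = -(I • K) := by
    have h := exp_mul_genH_mul_exp_neg_complex S hS z₀
    rw [show (2 : ℂ) * z₀ = (π / 2 : ℂ) * I by rw [hz₀]; ring,
      show (π / 2 : ℂ) = ((π / 2 : ℝ) : ℂ) by push_cast; ring, Complex.cosh_mul_I,
      Complex.sinh_mul_I, ← Complex.ofReal_cos, ← Complex.ofReal_sin, Real.cos_pi_div_two,
      Real.sin_pi_div_two] at h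
    simpa [hU, hU'] using h
  have hH' : H = U' * (-(I • K)) * U := by
    rw [← hkey, ← mul_assoc, ← mul_assoc, hU'U, one_mul, mul_assoc, hU'U, mul_one]
  -- rewrite `πi H` as a conjugate of `π K`
  set M : Matrix ι ι ℂ := U' * K * U with hM
  have e1 : U' * (-(I • K)) * U = -(I • M) := by
    rw [hM, Matrix.mul_neg, Matrix.mul_smul, Matrix.neg_mul, Matrix.smul_mul]
  have e2 : U' * ((π : ℂ) • K) * U = (π : ℂ) • M := by
    rw [hM, Matrix.mul_smul, Matrix.smul_mul]
  have hsmul : ((π : ℂ) * I) • H = U' * ((π : ℂ) • K) * U := by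
    rw [hH', e1, e2, smul_neg, smul_smul,
      show (π : ℂ) * I * I = -π by rw [mul_assoc, I_mul_I, mul_neg_one], neg_smul, neg_neg]
  have hconj : exp (U' * ((π : ℂ) • K) * U) = U' * exp ((π : ℂ) • K) * U :=
    exp_conj_of_mul_eq_one hU'U hUU' _
  have hexpK : exp ((π : ℂ) • K) = S (-1) := by
    rw [Complex.coe_smul, ← apply_toSL S hS isGen_kMat π, toSL_kMat_pi]
  -- `S(−1)` is central
  have hc : Commute (S (-1)) A' :=
    commute_gen S hS (-1) isGen_aMat (neg_one_mul_toSL isGen_aMat)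
  have hcU : Commute (S (-1)) U := (hc.smul_right z₀).exp_right
  calc exp (((π : ℂ) * I) • H) = exp (U' * ((π : ℂ) • K) * U) := by rw [hsmul]
    _ = U' * exp ((π : ℂ) • K) * U := hconj
    _ = U' * S (-1) * U := by rw [hexpK]
    _ = S (-1) := by rw [mul_assoc, hcU.eq, ← mul_assoc, hU'U, one_mul]

/-- The same for the half generator `Y = H/2` of the boosts `diag(e^{χ/2}, e^{−χ/2})`:
**`exp (2πi Y) = S(−1)`**, the input of the spin–statistics theorem.
[cite: StreaterWightman1964, §4-4 eq. (4-51)] -/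
theorem exp_two_pi_mul_I_smul_half_genH (hS : Continuous S) :
    exp ((2 * (π : ℂ) * I) • ((2⁻¹ : ℂ) • gen S hS hMat isGen_hMat)) = S (-1) := by
  rw [smul_smul, show 2 * (π : ℂ) * I * 2⁻¹ = (π : ℂ) * I by ring]
  exact exp_pi_mul_I_smul_genH S hS

omit [Nonempty ι] in
/-- The boosts of rapidity `χ`, `diag(e^{χ/2}, e^{−χ/2}) = exp ((χ/2) h)`, are sent to
`exp (χ Y)` with `Y = H/2`. [cite: StreaterWightman1964, §1-3 eq. (1-26)] -/
theorem apply_toSL_hMat_half (hS : Continuous S) (χ : ℝ) :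
    S (toSL hMat isGen_hMat (χ / 2)) = exp ((χ : ℂ) • ((2⁻¹ : ℂ) • gen S hS hMat isGen_hMat)) := by
  rw [apply_toSL S hS isGen_hMat, smul_smul, ← Complex.coe_smul]
  congr 1
  push_cast
  ring_nf

end Main

end SL2C

end Literature.MathematicalPhysics.QuantumLattice
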